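import Summits.ResolutionOfSingularities.ResolutionOfSingularities.Theorems.EquisingularLiftEquisingularLiftReducedStrictTransformBlowup
import Summits.ResolutionOfSingularities.ResolutionOfSingularities.Theorems.EquisingularLiftEquisingularLiftSectionComapPoint
import Summits.ResolutionOfSingularities.ResolutionOfSingularities.Theorems.EquisingularLiftEquisingularLiftSectionKer
import Literature.AlgebraicGeometry.Resolution.CurveBlowupDeltaDrop
import Literature.AlgebraicGeometry.Resolution.QuasiExcellentCurveDelta
import Literature.AlgebraicGeometry.Resolution.BlowupDimension
import Literature.AlgebraicGeometry.Resolution.QuasiExcellentClosedSubschemes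
import Literature.AlgebraicGeometry.Resolution.QuasiExcellentField
import Literature.AlgebraicGeometry.Resolution.GeneralLU
import Literature.AlgebraicGeometry.Resolution.GeneralLUProofs
import HarnessLib

/-!
# `EquisingularLift`, line `strata-split` — the `δ`-drop of a curve under a section blow-up

Crux `stmt-ResolutionOfSingularities-15660` = `Theses.EquisingularLift.EquisingularLift`; helper sub-goal L3 of
the registered stub `stub_resolveOnePoint_dimOne` (the curve case). Setting: `O` a discrete valuation ring,
`r' : X' → Spec O` proper with `X'` integral, `s` a section of `r'` (a closed immersion, centre
`C := V(ker s) = s(Spec O)`), `τ : X'' → X'` a blow-up of `X'` along `ker s`; `S' ⊆ X'` an irreducible closed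
subset of the special fibre, not contained in `C`, carrying the reduced (integral) closed subscheme
`Γ' := V(S')_red`, which passes through the closed point `z₁ = s(𝔪)` at a NON-regular point and has
dimension `≤ 1`; its strict transform is the reduced closed subscheme `Γ'' := V(closure τ⁻¹(S' ∖ C))_red` of
`X''`.

CLAIM (`curveBlowup_of_isBlowup_section`): `dim Γ'' ≤ 1`, the total `δ`-invariants `Σ_y δ(𝒪_{Γ',y})`,
`Σ_y δ(𝒪_{Γ'',y})` are finite sums of finite numbers, and `Σ δ(Γ'') < Σ δ(Γ')` (Kollár 2007, §1.4).

Proof (assembly of tree facts).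
* `ρ : Γ'' → Γ'` over `τ` is proper and a blow-up of `Γ'` along `(ker s)·𝒪_{Γ'} = (ker s).comap ι`
  (`exists_isBlowup_reducedStrictTransform`, Stacks 080E (1)).
* That centre is the vanishing ideal of the reduced closed point `z₁`
  (`ker_section_comap_eq_vanishingIdeal`: the section meets the special fibre transversally); `{z₁}` is
  closed since `{s(𝔪)}` is closed in `X'` (`section_isClosedImmersion_and_isRegular_ker`).
* `Γ'` and `Γ''` are Noetherian (closed in the Noetherian `X'`, `X''`) and QUASI-EXCELLENT: being reduced and
  lying over the closed point of `Spec O`, they are locally of finite type over the residue FIELD `κ(O)`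
  (`exists_fac_residueField_of_range_subset_closedPoint`: `O → Γ(Γ', 𝒪)` kills `𝔪`, hence factors through
  `κ(O)`), and schemes locally of finite type over a field are quasi-excellent (Stacks 07QU, discharged in the
  tree as `Stacks07QU_holds`, with `isQuasiExcellentRing_of_field`). (A general DVR is not quasi-excellent,
  so the route through `X'` is not available.)
* Hence the hypotheses of the `δ`-drop theorem `IsBlowup.finsum_pointDelta_lt_of_vanishingIdeal` hold
  (`QuasiExcellentCurveDelta.lean`: finite normalisations of the local rings, `δ < ∞`, finite support of
  `δ`); `dim 𝒪_{Γ',z₁} = 1` and `𝒪_{Γ',z₁}` is not a discrete valuation ring because fields and discrete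
  valuation rings are regular; and `dim Γ'' ≤ 1` by `IsBlowup.topologicalKrullDim_le`.

References: J. Kollár, *Lectures on Resolution of Singularities* (2007), §1.4; The Stacks Project,
Tags 080E, 07QU.
-/

set_option linter.dupNamespace false -- mandated namespace `Summit.<Summit>.<Problem>` of this single-conjunct summit
set_option linter.overlappingInstances false -- registered signature carries `[IsDomain O] [IsDiscreteValuationRing O]`

noncomputable section

open CategoryTheory CategoryTheory.Limits AlgebraicGeometry TopologicalSpace Topology
open Literature.AlgebraicGeometry.Resolution

universe u

namespace Summit.ResolutionOfSingularities.ResolutionOfSingularities.Cruxes.EquisingularLift.StrataSplit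

/-- A morphism `g : Z → Spec O` (`O` local) from a REDUCED scheme whose image is the closed point factors
through the residue field: `g = g₀ ≫ Spec(O → κ(O))` for some `g₀ : Z → Spec κ(O)` — the ring map
`O → Γ(Z, 𝒪_Z)` kills `𝔪_O` (`appTop_eq_zero_of_range_subset_closedPoint`). [folklore] -/
theorem exists_fac_residueField_of_range_subset_closedPoint {O : Type u} [CommRing O] [IsLocalRing O]
    {Z : Scheme.{u}} [IsReduced Z] (g : Z ⟶ Spec (.of O))
    (hg : Set.range g ⊆ {IsLocalRing.closedPoint O}) :
    ∃ g₀ : Z ⟶ Spec (.of (IsLocalRing.ResidueField O)),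
      g₀ ≫ Spec.map (CommRingCat.ofHom (IsLocalRing.residue O)) = g := by
  -- the ring map `O → Γ(Z, 𝒪_Z)` of `g` and its factorisation through `κ(O) = O ⧸ 𝔪`
  let φ : CommRingCat.of O ⟶ Γ(Z, ⊤) := (Scheme.ΓSpecIso (.of O)).inv ≫ g.appTop
  have hφ : ∀ a ∈ IsLocalRing.maximalIdeal O, φ.hom a = 0 := fun a ha => by
    simp only [φ, CommRingCat.hom_comp, RingHom.comp_apply]
    exact appTop_eq_zero_of_range_subset_closedPoint g hg ha
  let φbar : IsLocalRing.ResidueField O →+* Γ(Z, ⊤) :=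
    Ideal.Quotient.lift (IsLocalRing.maximalIdeal O) φ.hom hφ
  have hfac : CommRingCat.ofHom (IsLocalRing.residue O) ≫ CommRingCat.ofHom φbar = φ := by
    ext a
    simp only [CommRingCat.hom_comp, CommRingCat.hom_ofHom, RingHom.comp_apply]
    exact Ideal.Quotient.lift_mk _ _ _
  have hg' : Z.toSpecΓ ≫ Spec.map φ = g := by
    simp only [φ, Spec.map_comp]
    rw [← Category.assoc, ← Scheme.toSpecΓ_naturality, Category.assoc, toSpecΓ_SpecMap_ΓSpecIso_inv,
      Category.comp_id]
  refine ⟨Z.toSpecΓ ≫ Spec.map (CommRingCat.ofHom φbar), ?_⟩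
  rw [Category.assoc, ← Spec.map_comp, hfac, hg']

/-- A reduced scheme locally of finite type over a local ring `O` and lying over the closed point of `Spec O`
is quasi-excellent: it is locally of finite type over the residue field `κ(O)`, and schemes locally of finite
type over a field are quasi-excellent (Stacks 07QU, `Stacks07QU_holds`; `isQuasiExcellentRing_of_field`).
[cite: StacksProject, Tag 07QU] -/
theorem isQuasiExcellent_of_range_subset_closedPoint {O : Type u} [CommRing O] [IsLocalRing O]
    {Z : Scheme.{u}} [IsReduced Z] (g : Z ⟶ Spec (.of O)) [LocallyOfFiniteType g]
    (hg : Set.range g ⊆ {IsLocalRing.closedPoint O}) : Scheme.IsQuasiExcellent Z := by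
  obtain ⟨g₀, hg₀⟩ := exists_fac_residueField_of_range_subset_closedPoint g hg
  haveI : LocallyOfFiniteType (g₀ ≫ Spec.map (CommRingCat.ofHom (IsLocalRing.residue O))) := by
    rw [hg₀]; infer_instance
  haveI : LocallyOfFiniteType g₀ :=
    locallyOfFiniteType_of_comp g₀ (Spec.map (CommRingCat.ofHom (IsLocalRing.residue O)))
  exact Scheme.isQuasiExcellent_of_locallyOfFiniteType_of_isQuasiExcellentRing Stacks07QU_holds
    (isQuasiExcellentRing_of_field (IsLocalRing.ResidueField O)) g₀

/-- **The `δ`-drop under the blow-up of a non-regular reduced closed point of a quasi-excellent curve**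
(Kollár 2007, §1.4), packaged: for integral Noetherian quasi-excellent `C`, `C'` with `dim C ≤ 1` and a proper
blow-up `ρ : C' → C` of the reduced closed point `x` with `𝒪_{C,x}` not regular, `dim C' ≤ 1`, the total
`δ`-invariants of `C`, `C'` are finite sums of finite numbers, and `Σ δ(C') < Σ δ(C)`.
[cite: Kollar2007, §1.4] -/
theorem finsum_pointDelta_lt_of_not_isRegularLocalRing {C C' : Scheme.{u}} [IsIntegral C] [IsIntegral C']
    [IsNoetherian C] [IsNoetherian C'] (hq : Scheme.IsQuasiExcellent C) (hq' : Scheme.IsQuasiExcellent C')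
    {ρ : C' ⟶ C} [IsProper ρ] {x : C} (hx : IsClosed ({x} : Set C))
    (hρ : IsBlowup ρ (Scheme.IdealSheafData.vanishingIdeal ⟨{x}, hx⟩))
    (hreg : ¬ IsRegularLocalRing (C.presheaf.stalk x)) (hdim : topologicalKrullDim C ≤ 1) :
    topologicalKrullDim C' ≤ 1 ∧ (Function.support (pointDelta C')).Finite ∧
      (∀ y : C', pointDelta C' y ≠ ⊤) ∧ (Function.support (pointDelta C)).Finite ∧
      (∀ y : C, pointDelta C y ≠ ⊤) ∧ ∑ᶠ y : C', pointDelta C' y < ∑ᶠ y : C, pointDelta C y := by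
  -- blowing up does not raise the dimension
  have hdim' : topologicalKrullDim C' ≤ 1 := by
    have h : topologicalKrullDim C ≤ (1 : ℕ) := by exact_mod_cast hdim
    exact_mod_cast hρ.topologicalKrullDim_le h
  -- `𝒪_{C,x}` is one-dimensional (a field is regular) and not a discrete valuation ring (regular)
  have h1 : ringKrullDim (C.presheaf.stalk x) = 1 := by
    rcases isField_or_ringKrullDim_eq_one hdim x with hF | h1
    · refine absurd ?_ hreg
      letI := hF.toField
      infer_instance
    · exact h1
  have hsing : ¬ IsDiscreteValuationRing (C.presheaf.stalk x) := fun _ => hreg inferInstance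
  -- the `δ`-hypotheses hold on quasi-excellent curves
  haveI := module_finite_integralClosure_stalk hq hdim x
  have hfin : ∀ x' : C', ρ x' = x →
      Module.Finite (C'.presheaf.stalk x') (integralClosure (C'.presheaf.stalk x') C'.functionField) :=
    fun x' _ => module_finite_integralClosure_stalk hq' hdim' x'
  have hsupp := finite_support_pointDelta hq hdim
  have htop := pointDelta_ne_top hq hdim
  obtain ⟨hsupp', hlt⟩ := hρ.finsum_pointDelta_lt_of_vanishingIdeal hx h1 hfin hsupp htop hsing
  exact ⟨hdim', hsupp', pointDelta_ne_top hq' hdim', hsupp, htop, hlt⟩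

/-- **Helper `curveBlowup_of_isBlowup_section`** (sub-goal L3 of `stub_resolveOnePoint_dimOne`, line
`strata-split`): under the blow-up `τ : X'' → X'` of the integral proper `X' → Spec O` (`O` a DVR) along a
section `s` through the closed point `z₁ = s(𝔪)`, the reduced strict transform `Γ''` of the curve `Γ' = V(S')_red`
(`S'` irreducible closed in the special fibre, `S' ⊄ s(Spec O)`, `z₁` a non-regular point of `Γ'`, `dim Γ' ≤ 1`)
is again a curve, and the total `δ`-invariant drops: `Σ_y δ(𝒪_{Γ'',y}) < Σ_y δ(𝒪_{Γ',y})`, both sums being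
finite sums of finite numbers — `Γ'' → Γ'` is the blow-up of the reduced non-regular point `z₁` of the
quasi-excellent curve `Γ'` (Kollár 2007, §1.4). [cite: Kollar2007, §1.4] -/
theorem curveBlowup_of_isBlowup_section : ∀ (O : Type) [CommRing O] [IsDomain O] [IsDiscreteValuationRing O] (X' X'' : AlgebraicGeometry.Scheme.{0}) [AlgebraicGeometry.IsIntegral X'] [AlgebraicGeometry.IsLocallyNoetherian X''] (r' : X' ⟶ AlgebraicGeometry.Spec (.of O)) [AlgebraicGeometry.IsProper r'] (s : AlgebraicGeometry.Spec (.of O) ⟶ X'), CategoryTheory.CategoryStruct.comp s r' = CategoryTheory.CategoryStruct.id _ → ∀ (τ : X'' ⟶ X'), Literature.AlgebraicGeometry.Resolution.IsBlowup τ s.ker → ∀ [AlgebraicGeometry.IsProper τ] (S' : Set X') (hS' : IsClosed S'), IsIrreducible S' → S' ⊆ r' ⁻¹' {IsLocalRing.closedPoint O} → ¬ S' ⊆ (s.ker.support : Set X') → ∀ [AlgebraicGeometry.IsIntegral (AlgebraicGeometry.Scheme.IdealSheafData.vanishingIdeal (⟨S', hS'⟩ : TopologicalSpace.Closeds X')).subscheme]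 [AlgebraicGeometry.IsIntegral (AlgebraicGeometry.Scheme.IdealSheafData.vanishingIdeal (⟨closure (τ ⁻¹' (S' \ (s.ker.support : Set X'))), isClosed_closure⟩ : TopologicalSpace.Closeds X'')).subscheme] (z₁ : ↥(AlgebraicGeometry.Scheme.IdealSheafData.vanishingIdeal (⟨S', hS'⟩ : TopologicalSpace.Closeds X')).subscheme), ((AlgebraicGeometry.Scheme.IdealSheafData.vanishingIdeal (⟨S', hS'⟩ : TopologicalSpace.Closeds X')).subschemeι z₁ : X') = s (IsLocalRing.closedPoint O) → ¬ IsRegularLocalRing ((AlgebraicGeometry.Scheme.IdealSheafData.vanishingIdeal (⟨S', hS'⟩ : TopologicalSpace.Closeds X')).subscheme.presheaf.stalk z₁) → topologicalKrullDim ↥(AlgebraicGeometry.Scheme.IdealSheafData.vanishingIdeal (⟨S', hS'⟩ : TopologicalSpace.Closeds X')).subscheme ≤ 1 → topologicalKrullDim ↥(AlgebraicGeometry.Scheme.IdealSheafData.vanishingIdeal (⟨closure (τ ⁻¹' (S' \ (s.ker.support : Set X'))), isClosed_closure⟩ : TopologicalSpace.Closeds X'')).subscheme ≤ 1 ∧ (Function.support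 (Literature.AlgebraicGeometry.Resolution.pointDelta (AlgebraicGeometry.Scheme.IdealSheafData.vanishingIdeal (⟨closure (τ ⁻¹' (S' \ (s.ker.support : Set X'))), isClosed_closure⟩ : TopologicalSpace.Closeds X'')).subscheme)).Finite ∧ (∀ y : ↥(AlgebraicGeometry.Scheme.IdealSheafData.vanishingIdeal (⟨closure (τ ⁻¹' (S' \ (s.ker.support : Set X'))), isClosed_closure⟩ : TopologicalSpace.Closeds X'')).subscheme, Literature.AlgebraicGeometry.Resolution.pointDelta (AlgebraicGeometry.Scheme.IdealSheafData.vanishingIdeal (⟨closure (τ ⁻¹' (S' \ (s.ker.support : Set X'))), isClosed_closure⟩ : TopologicalSpace.Closeds X'')).subscheme y ≠ ⊤) ∧ (Function.support (Literature.AlgebraicGeometry.Resolution.pointDelta (AlgebraicGeometry.Scheme.IdealSheafData.vanishingIdeal (⟨S', hS'⟩ : TopologicalSpace.Closeds X')).subscheme)).Finite ∧ (∀ y : ↥(AlgebraicGeometry.Scheme.IdealSheafData.vanishingIdeal (⟨S', hS'⟩ : TopologicalSpace.Closeds X')).subscheme, Literature.AlgebraicGeometry.Resolution.pointDelta (AlgebraicGeometry.Scheme.IdealSheafData.vanishingIdeal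 (⟨S', hS'⟩ : TopologicalSpace.Closeds X')).subscheme y ≠ ⊤) ∧ ∑ᶠ y : ↥(AlgebraicGeometry.Scheme.IdealSheafData.vanishingIdeal (⟨closure (τ ⁻¹' (S' \ (s.ker.support : Set X'))), isClosed_closure⟩ : TopologicalSpace.Closeds X'')).subscheme, Literature.AlgebraicGeometry.Resolution.pointDelta (AlgebraicGeometry.Scheme.IdealSheafData.vanishingIdeal (⟨closure (τ ⁻¹' (S' \ (s.ker.support : Set X'))), isClosed_closure⟩ : TopologicalSpace.Closeds X'')).subscheme y < ∑ᶠ y : ↥(AlgebraicGeometry.Scheme.IdealSheafData.vanishingIdeal (⟨S', hS'⟩ : TopologicalSpace.Closeds X')).subscheme, Literature.AlgebraicGeometry.Resolution.pointDelta (AlgebraicGeometry.Scheme.IdealSheafData.vanishingIdeal (⟨S', hS'⟩ : TopologicalSpace.Closeds X')).subscheme y := by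
  intro O _ _ _ X' X'' _ _ r' _ s hs τ hτ _ S' hS' hirr hSfib hSC _ _ z₁ hz₁ hreg hdim
  -- the two inclusions
  let ι₁ := (Scheme.IdealSheafData.vanishingIdeal (⟨S', hS'⟩ : Closeds X')).subschemeι
  let ι₂ := (Scheme.IdealSheafData.vanishingIdeal
    (⟨closure (τ ⁻¹' (S' \ (s.ker.support : Set X'))), isClosed_closure⟩ : Closeds X'')).subschemeι
  -- Noetherianity: `X'`, `X''` are of finite type over the Noetherian `O`, the curves are closed in them
  haveI : IsNoetherianRing (CommRingCat.of O) := inferInstanceAs (IsNoetherianRing O)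
  haveI : IsLocallyNoetherian X' := LocallyOfFiniteType.isLocallyNoetherian r'
  haveI : CompactSpace X' := QuasiCompact.compactSpace_of_compactSpace r'
  haveI : IsNoetherian X' := {}
  haveI : CompactSpace X'' := QuasiCompact.compactSpace_of_compactSpace τ
  haveI : IsNoetherian X'' := {}
  haveI : IsNoetherian (Scheme.IdealSheafData.vanishingIdeal (⟨S', hS'⟩ : Closeds X')).subscheme :=
    isNoetherian_of_isClosedImmersion ι₁
  haveI : IsNoetherian (Scheme.IdealSheafData.vanishingIdeal
      (⟨closure (τ ⁻¹' (S' \ (s.ker.support : Set X'))), isClosed_closure⟩ : Closeds X'')).subscheme :=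
    isNoetherian_of_isClosedImmersion ι₂
  -- `Γ'` lies over the closed point of `Spec O`
  have hrange₁ : Set.range ⇑(ι₁ ≫ r') ⊆ {IsLocalRing.closedPoint O} := by
    rintro _ ⟨z, rfl⟩
    rw [Scheme.Hom.comp_apply]
    refine hSfib ?_
    have hz : ι₁ z ∈ Set.range ι₁ := ⟨z, rfl⟩
    rw [Scheme.IdealSheafData.range_subschemeι, Scheme.IdealSheafData.coe_support_vanishingIdeal] at hz
    exact hz
  -- the strict transform `ρ : Γ'' → Γ'`, proper, a blow-up along `(ker s)·𝒪_{Γ'}`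
  obtain ⟨ρ, hρι, hρp, hρb⟩ := exists_isBlowup_reducedStrictTransform X' X'' τ s.ker hτ S' hS' hirr hSC
  haveI : IsProper ρ := hρp
  -- quasi-excellence of the two curves (finite type over the residue field)
  have hq₁ := isQuasiExcellent_of_range_subset_closedPoint (ι₁ ≫ r') hrange₁
  have hrange₂ : Set.range ⇑(ρ ≫ ι₁ ≫ r') ⊆ {IsLocalRing.closedPoint O} := by
    rintro _ ⟨z, rfl⟩
    rw [Scheme.Hom.comp_apply]
    exact hrange₁ ⟨ρ z, rfl⟩
  have hq₂ := isQuasiExcellent_of_range_subset_closedPoint (ρ ≫ ι₁ ≫ r') hrange₂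
  -- the centre of `ρ` is the reduced closed point `z₁`
  have hclpt : IsClosed ({s (IsLocalRing.closedPoint O)} : Set X') :=
    (section_isClosedImmersion_and_isRegular_ker O X' r' s hs).2.2.1
  have hcl : IsClosed ({z₁} : Set (Scheme.IdealSheafData.vanishingIdeal (⟨S', hS'⟩ : Closeds X')).subscheme) := by
    have e : ({z₁} : Set _) = ι₁ ⁻¹' {s (IsLocalRing.closedPoint O)} := by
      ext z
      simp only [Set.mem_singleton_iff, Set.mem_preimage]
      constructor
      · rintro rfl
        exact hz₁
      · intro hz
        exact ι₁.isClosedEmbedding.injective (hz.trans hz₁.symm)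
    rw [e]
    exact hclpt.preimage ι₁.continuous
  have hcomap : s.ker.comap ι₁ = Scheme.IdealSheafData.vanishingIdeal ⟨{z₁}, hcl⟩ :=
    ker_section_comap_eq_vanishingIdeal O X' _ r' s hs ι₁ hrange₁ z₁ hz₁ hcl
  rw [hcomap] at hρb
  exact finsum_pointDelta_lt_of_not_isRegularLocalRing hq₁ hq₂ hcl hρb hreg hdim

end Summit.ResolutionOfSingularities.ResolutionOfSingularities.Cruxes.EquisingularLift.StrataSplit

end
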